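import Mathlib
import HarnessLib
import Literature.Probability.MarkovChains.QMatrix
import Literature.Probability.MarkovChains.BirthDeathChain
import Literature.Probability.MarkovChains.TreeGraphReversible

/-!
# The birth-and-death process on `{0,…,N}`: generator, invariant law `π(i) = π(0) Π λ_{n−1}/μ_n`, reversibility (Brémaud Example 7.4.13; Kelly §1.3)

HONEST FRAMING: exact (Metropolis-corrected) sampling algorithms for lattice gauge theory; figures
of merit are autocorrelation/cost numbers at stated couplings and volumes; no continuum-physics claim.

Sources: P. Brémaud, *Probability Theory and Stochastic Processes*, Springer 2020 [Bremaud2020],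
Definition 7.2.16 (birth-and-death generator `q_{i,i+1} = λ_i`, `q_{i,i−1} = μ_i 1_{i≥1}`),
Example 7.4.13 "The birth-and-death process" (global balance equations, eq. (7.49)
`π(i) = π(0) Π_{n=1}^{i} λ_{n−1}/μ_n`, (7.50)–(7.51): ergodicity "automatically satisfied when the
state space is finite"), §7.4.1 after Thm 7.4.16 (a stationary chain whose generator satisfies the
detailed balance equations (7.54) `π(i)q_{ij} = π(j)q_{ji}` is called reversible); F. P. Kelly,
*Reversibility and Stochastic Networks*, Wiley 1979 [Kelly1979], §1.3 ("a stationary birth and death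
process is reversible").  Vocabulary of `QMatrix.lean` (`IsQMatrix`, `exitRate`, `IsInvariantQ`,
`QDetailedBalance`, `uniformizedKernel`, `unifRate`, `ctSemigroup Q t = e^{tQ}`) and of
`BirthDeathChain.lean` (`bdKernel n p q`, `bdWeight p q k = Π_{i<k} p_i/q_{i+1}`, `bdLaw`).
Everything is PROVED (0 named facts); finite state space `E = {0, 1, …, N}` throughout.

* `bdGenerator N lam mu` — the generator `A` of Example 7.4.13 on `Fin (N+1)`: `q_{i,i+1} = λ_i`,
  `q_{i,i−1} = μ_i`, `q_{ii} = −(λ_i + μ_i)` (conventions `μ_0 = λ_N = 0` where row sums matter);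
  DEFINED as `bdKernel N lam mu − I` [cite: Bremaud2020, Def. 7.2.16; Example 7.4.13 (the matrix `A`)];
* `bdGenerator_isQMatrix` — `A` is a (stable, conservative) generator [cite: Bremaud2020,
  Example 7.4.13];
* `uniformizedKernel_bdGenerator` — uniformization at rate `Λ` turns the birth-and-death PROCESS
  into the birth-and-death CHAIN with `p_k = λ_k/Λ`, `q_k = μ_k/Λ` [cite: Bremaud2020, Example 7.3.7
  with eq. (7.18) (`K = I + A/Λ`)];
* `qDetailedBalance_bdGenerator` — the weights `w_i = Π_{n=1}^{i} λ_{n−1}/μ_n` satisfy the detailed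
  balance equations (7.54) `w_i q_{ij} = w_j q_{ji}` [cite: Bremaud2020, Thm 7.4.15 eq. (7.54) and
  the definition of a reversible pair `(A, π)`]; [cite: Kelly1979, §1.3];
* `isInvariantQ_bdWeight` — hence `wA = 0` (global balance) [cite: Bremaud2020, Example 7.4.13
  (the global balance equations)]; via [cite: Norris1997, Lemma 3.7.2];
* **EQ. (7.49)** `Bremaud2020_eq_7_49` — conversely EVERY invariant measure `ν` (`νA = 0`) is
  `ν(i) = ν(0) Π_{n=1}^{i} λ_{n−1}/μ_n` ("Solving this system with initial condition `π(0)` gives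
  (7.49)"; `μ_i > 0` for `i ≥ 1`) [cite: Bremaud2020, Example 7.4.13 eq. (7.49)] — here through the
  uniformized chain and the cut argument `bdKernel_detailedBalance_of_isStationary` (a stationary
  birth-and-death chain is in detailed balance) of `TreeGraphReversible.lean` [cite: Kelly1979, §1.3];
* **EQ. (7.50)** `Bremaud2020_eq_7_50` — the unique invariant probability vector is
  `π = bdLaw N lam mu`, `π(i) = w_i / Σ_j w_j` (finite `E`: the ergodicity condition (7.51) is
  automatic) [cite: Bremaud2020, Example 7.4.13 eqs. (7.50)–(7.51)];
* `bdLaw_isStationary_ctSemigroup`, `bdLaw_detailedBalance_ctSemigroup` — `π P(t) = π` and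
  `π(i) p_{ij}(t) = π(j) p_{ji}(t)` for all `t`: the stationary birth-and-death process is reversible
  [cite: Kelly1979, §1.3]; [cite: Bremaud2020, Thm 7.4.15].

NOT CLAIMED: the countable case `E = ℕ` and the ergodicity criterion (7.51) as a convergence
condition; regularity / non-explosion (automatic here); the path-level statement of Thm 7.4.15
(reversed process equal in distribution).

Context (cell pub-lqcd, venture LatticeQCDFlow): the M/M/1-type occupation processes used as toy
models for queue-like accept/reject dynamics, and the simplest continuous-time reversible samplers;
the explicit product-form law is the calibration target for any numerical treatment of such chains.
-/

namespace Literature.Probability.MarkovChains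

open Finset Matrix

variable {N : ℕ} {lam mu : ℕ → ℝ}

/-! ## The generator -/

/-- The birth-and-death GENERATOR on `{0,…,N}` with birth rates `λ_k` (`k → k+1`) and death rates
`μ_k` (`k → k−1`): `q_{k,k+1} = λ_k`, `q_{k,k−1} = μ_k`, `q_{kk} = −λ_k − μ_k`, all other entries `0`;
as a matrix, `A = K − I` for the birth-and-death kernel `K = bdKernel N λ μ` with the SAME parameters
(whose diagonal is `1 − λ_k − μ_k`). [cite: Bremaud2020, Def. 7.2.16; Example 7.4.13 (the matrix
`A`)] -/
noncomputable def bdGenerator (N : ℕ) (lam mu : ℕ → ℝ) : Fin (N + 1) → Fin (N + 1) → ℝ :=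
  fun i j => bdKernel N lam mu i j - if i = j then 1 else 0

/-- `q_{k,k+1} = λ_k`. [cite: Bremaud2020, Def. 7.2.16] -/
theorem bdGenerator_apply_succ {i j : Fin (N + 1)} (h : j.val = i.val + 1) :
    bdGenerator N lam mu i j = lam i.val := by
  have hne : i ≠ j := fun e => by rw [e] at h; omega
  simp [bdGenerator, bdKernel_apply_succ h, hne]

/-- `q_{k,k−1} = μ_k`. [cite: Bremaud2020, Def. 7.2.16] -/
theorem bdGenerator_apply_pred {i j : Fin (N + 1)} (h : i.val = j.val + 1) :
    bdGenerator N lam mu i j = mu i.val := by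
  have hne : i ≠ j := fun e => by rw [e] at h; omega
  simp [bdGenerator, bdKernel_apply_pred h, hne]

/-- `q_{kk} = −(λ_k + μ_k)`. [cite: Bremaud2020, Example 7.4.13 (diagonal of `A`)] -/
theorem bdGenerator_apply_self (i : Fin (N + 1)) :
    bdGenerator N lam mu i i = -(lam i.val + mu i.val) := by
  simp [bdGenerator, bdKernel_apply_self]
  ring

/-- All other entries vanish (`q_{ij} = 0` if `j ∉ {i−1, i, i+1}`). [cite: Bremaud2020, Def. 7.2.16] -/
theorem bdGenerator_apply_of_ne {i j : Fin (N + 1)} (h1 : j.val ≠ i.val + 1) (h2 : i.val ≠ j.val + 1)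
    (h3 : i ≠ j) : bdGenerator N lam mu i j = 0 := by
  simp [bdGenerator, bdKernel_apply_of_ne h1 h2 h3, h3]

/-- Off the diagonal the generator agrees with the kernel: `q_{ij} = K(i,j)` (`i ≠ j`).
[cite: Bremaud2020, Example 7.2.17 eq. (7.18) (`A = λ(K − I)`, here `λ = 1`)] -/
theorem bdGenerator_apply_of_ne' {i j : Fin (N + 1)} (h : i ≠ j) :
    bdGenerator N lam mu i j = bdKernel N lam mu i j := by
  simp [bdGenerator, h]

/-- The exit rates are `q_k = λ_k + μ_k`. [cite: Bremaud2020, Example 7.4.13] -/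
theorem exitRate_bdGenerator (i : Fin (N + 1)) :
    exitRate (bdGenerator N lam mu) i = lam i.val + mu i.val := by
  rw [exitRate, bdGenerator_apply_self, neg_neg]

/-- **`A` is a generator** (Q-matrix: off-diagonal entries `≥ 0`, zero row sums) for `λ, μ ≥ 0`
with the boundary conventions `μ_0 = 0`, `λ_N = 0`. [cite: Bremaud2020, Example 7.4.13 (the matrix
`A`; "with the convention `μ_{N+1} = 0` if `E = {0, 1, …, N}`")] -/
theorem bdGenerator_isQMatrix (hlam : ∀ k, 0 ≤ lam k) (hmu : ∀ k, 0 ≤ mu k) (hmu0 : mu 0 = 0)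
    (hlamN : lam N = 0) : IsQMatrix (bdGenerator N lam mu) := by
  refine ⟨fun i j hij => ?_, fun i => ?_⟩
  · rw [bdGenerator_apply_of_ne' hij, bdKernel_apply_eq_add]
    refine add_nonneg (add_nonneg ?_ ?_) ?_
    · split_ifs
      · exact hlam _
      · exact le_rfl
    · split_ifs
      · exact hmu _
      · exact le_rfl
    · rw [if_neg hij]
  · simp only [bdGenerator, sum_sub_distrib, sum_bdKernel hmu0 hlamN i, sum_ite_eq, mem_univ,
      if_true, sub_self]

/-! ## Uniformization: the birth-and-death process watched at Poisson times is a birth-and-death chain -/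

/-- `K = I + A/Λ` is the birth-and-death CHAIN with `p_k = λ_k/Λ`, `q_k = μ_k/Λ` (and holding
`r_k = 1 − (λ_k + μ_k)/Λ`); a formal identity for every `Λ` (Lean's `x/0 = 0`), meaningful for
`Λ ≥ max_k (λ_k + μ_k)`, `Λ > 0`. [cite: Bremaud2020, Example 7.3.7 with Example 7.2.17 eq. (7.18)] -/
theorem uniformizedKernel_bdGenerator (Λ : ℝ) :
    uniformizedKernel (bdGenerator N lam mu) Λ =
      bdKernel N (fun k => lam k / Λ) (fun k => mu k / Λ) := by
  funext i j
  show (if j = i then 1 else 0) + bdGenerator N lam mu i j / Λ = _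
  by_cases h1 : j.val = i.val + 1
  · have h3 : j ≠ i := fun h => by rw [h] at h1; omega
    rw [if_neg h3, bdGenerator_apply_succ h1, bdKernel_apply_succ h1, zero_add]
  by_cases h2 : i.val = j.val + 1
  · have h3 : j ≠ i := fun h => by rw [h] at h2; omega
    rw [if_neg h3, bdGenerator_apply_pred h2, bdKernel_apply_pred h2, zero_add]
  by_cases h3 : i = j
  · subst h3
    rw [if_pos rfl, bdGenerator_apply_self, bdKernel_apply_self]
    ring
  · rw [if_neg (Ne.symm h3), bdGenerator_apply_of_ne h1 h2 h3, bdKernel_apply_of_ne h1 h2 h3,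
      zero_div, add_zero]

/-! ## Detailed balance, invariance, and eq. (7.49) -/

/-- **The weights `w_i = Π_{n=1}^{i} λ_{n−1}/μ_n` are in detailed balance with the generator:**
`w_i q_{ij} = w_j q_{ji}` (`μ_k ≠ 0` for `1 ≤ k ≤ N`). [cite: Bremaud2020, Thm 7.4.15 eq. (7.54)
and the definition of a reversible pair `(A, π)` (§7.4.1)] [cite: Kelly1979, §1.3 ("a stationary
birth and death process is reversible")] -/
theorem qDetailedBalance_bdGenerator (hmu : ∀ k, 1 ≤ k → k ≤ N → mu k ≠ 0) :
    QDetailedBalance (fun i : Fin (N + 1) => bdWeight lam mu i.val) (bdGenerator N lam mu) := by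
  intro i j
  by_cases h : i = j
  · subst h
    rfl
  · rw [bdGenerator_apply_of_ne' h, bdGenerator_apply_of_ne' (Ne.symm h)]
    exact LevinPeres2017_prop_2_8 hmu i j

/-- **Global balance:** `wA = 0` — `λ_0 w(0) = μ_1 w(1)` and
`(λ_i + μ_i) w(i) = λ_{i−1} w(i−1) + μ_{i+1} w(i+1)`. [cite: Bremaud2020, Example 7.4.13 (the global
balance equations)]; from detailed balance by [cite: Norris1997, Lemma 3.7.2]. -/
theorem isInvariantQ_bdWeight (hlam : ∀ k, 0 ≤ lam k) (hmu : ∀ k, 0 ≤ mu k) (hmu0 : mu 0 = 0)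
    (hlamN : lam N = 0) (hmu' : ∀ k, 1 ≤ k → k ≤ N → mu k ≠ 0) :
    IsInvariantQ (fun i : Fin (N + 1) => bdWeight lam mu i.val) (bdGenerator N lam mu) :=
  Norris1997_lemma_3_7_2 (bdGenerator_isQMatrix hlam hmu hmu0 hlamN) (qDetailedBalance_bdGenerator hmu')

/-- An invariant measure of the generator is a stationary measure of the uniformized
birth-and-death chain, which is a transition matrix at the rate `Λ = unifRate A` (`Λ > 0`,
`Λ ≥ λ_k + μ_k`). [cite: Bremaud2020, Example 7.3.7 (choice of `λ > sup_i q_i`) and Example 7.2.10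
(stationary distributions of the chain and of its uniformization agree)] -/
theorem isStationary_bdKernel_of_isInvariantQ (hlam : ∀ k, 0 ≤ lam k) (hmu : ∀ k, 0 ≤ mu k)
    (hmu0 : mu 0 = 0) (hlamN : lam N = 0) {ν : Fin (N + 1) → ℝ}
    (hν : IsInvariantQ ν (bdGenerator N lam mu)) :
    IsStationary ν (bdKernel N (fun k => lam k / unifRate (bdGenerator N lam mu))
      (fun k => mu k / unifRate (bdGenerator N lam mu))) := by
  have hQ := bdGenerator_isQMatrix hlam hmu hmu0 hlamN
  have hΛ := unifRate_pos hQ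
  rw [← uniformizedKernel_bdGenerator (unifRate (bdGenerator N lam mu))]
  exact (isInvariantQ_iff_isStationary_uniformizedKernel _ hΛ.ne' ν).1 hν

/-- The birth-and-death kernel only reads its parameters at the states `k ≤ n`. [cite:
LevinPeres2017, §2.5 (definition of the chain by `{(p_k, r_k, q_k)}_{k=0}^{n}`)] -/
theorem bdKernel_congr {n : ℕ} {p p' q q' : ℕ → ℝ} (hp : ∀ k, k ≤ n → p k = p' k)
    (hq : ∀ k, k ≤ n → q k = q' k) : bdKernel n p q = bdKernel n p' q' := by
  funext i j
  rw [bdKernel_apply_eq_add, bdKernel_apply_eq_add, hp i.val (Nat.lt_succ_iff.mp i.isLt),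
    hq i.val (Nat.lt_succ_iff.mp i.isLt)]

/-- The cut equations of an invariant measure: `λ_i ν(i) = μ_{i+1} ν(i+1)` for `i < N` (detailed
balance across the cut `{0,…,i} | {i+1,…,N}` of the uniformized chain). [cite: Kelly1979, §1.3
("a stationary birth and death process is reversible, by Lemma 1.5")] [cite: Bremaud2020,
Example 7.4.13 (from the global balance equations to (7.49))] -/
theorem IsInvariantQ.bd_cut (hlam : ∀ k, 0 ≤ lam k) (hmu : ∀ k, 0 ≤ mu k) (hmu0 : mu 0 = 0)
    (hlamN : lam N = 0) {ν : Fin (N + 1) → ℝ} (hν : IsInvariantQ ν (bdGenerator N lam mu))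
    {i j : Fin (N + 1)} (h : j.val = i.val + 1) : lam i.val * ν i = mu j.val * ν j := by
  have hQ := bdGenerator_isQMatrix hlam hmu hmu0 hlamN
  set Λ := unifRate (bdGenerator N lam mu) with hΛdef
  have hΛ : 0 < Λ := unifRate_pos hQ
  have hle : ∀ k : Fin (N + 1), lam k.val + mu k.val ≤ Λ := fun k => by
    rw [← exitRate_bdGenerator]; exact exitRate_le_unifRate hQ k
  -- truncated, rescaled parameters: a genuine birth-and-death transition matrix
  set p : ℕ → ℝ := fun k => if k ≤ N then lam k / Λ else 0 with hpdef
  set q : ℕ → ℝ := fun k => if k ≤ N then mu k / Λ else 0 with hqdef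
  have hpk : ∀ k, k ≤ N → p k = lam k / Λ := fun k hk => by simp [hpdef, hk]
  have hqk : ∀ k, k ≤ N → q k = mu k / Λ := fun k hk => by simp [hqdef, hk]
  have hp0 : ∀ k, 0 ≤ p k := fun k => by
    by_cases hk : k ≤ N
    · rw [hpk k hk]; exact div_nonneg (hlam k) hΛ.le
    · simp [hpdef, hk]
  have hq0 : ∀ k, 0 ≤ q k := fun k => by
    by_cases hk : k ≤ N
    · rw [hqk k hk]; exact div_nonneg (hmu k) hΛ.le
    · simp [hqdef, hk]
  have hpq : ∀ k, p k + q k ≤ 1 := fun k => by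
    by_cases hk : k ≤ N
    · rw [hpk k hk, hqk k hk, ← add_div, div_le_one hΛ]
      exact hle ⟨k, Nat.lt_succ_of_le hk⟩
    · simp [hpdef, hqdef, hk]
  have hq00 : q 0 = 0 := by rw [hqk 0 (Nat.zero_le _), hmu0, zero_div]
  have hpN : p N = 0 := by rw [hpk N le_rfl, hlamN, zero_div]
  have hK : bdKernel N p q = bdKernel N (fun k => lam k / Λ) (fun k => mu k / Λ) :=
    bdKernel_congr hpk hqk
  have hst : IsStationary ν (bdKernel N p q) := by
    rw [hK]
    exact isStationary_bdKernel_of_isInvariantQ hlam hmu hmu0 hlamN hν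
  have hDB := bdKernel_detailedBalance_of_isStationary hp0 hq0 hpq hq00 hpN hst i j
  rw [bdKernel_apply_succ h, bdKernel_apply_pred h, hpk i.val (by omega),
    hqk j.val (by have := j.isLt; omega), mul_div_assoc', mul_div_assoc',
    div_left_inj' hΛ.ne'] at hDB
  calc lam i.val * ν i = ν i * lam i.val := mul_comm _ _
    _ = ν j * mu j.val := hDB
    _ = mu j.val * ν j := mul_comm _ _

/-- **EQ. (7.49) (Brémaud).**  Every invariant measure `ν` of the birth-and-death generator
(`νA = 0`; `λ, μ ≥ 0`, `μ_0 = λ_N = 0`, `μ_i ≠ 0` for `1 ≤ i ≤ N`) is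
`ν(i) = ν(0) Π_{n=1}^{i} λ_{n−1}/μ_n` — "Solving this system with initial condition `π(0)` gives
(7.49)". [cite: Bremaud2020, Example 7.4.13 eq. (7.49)] -/
theorem Bremaud2020_eq_7_49 (hlam : ∀ k, 0 ≤ lam k) (hmu : ∀ k, 0 ≤ mu k) (hmu0 : mu 0 = 0)
    (hlamN : lam N = 0) (hmu' : ∀ k, 1 ≤ k → k ≤ N → mu k ≠ 0) {ν : Fin (N + 1) → ℝ}
    (hν : IsInvariantQ ν (bdGenerator N lam mu)) (i : Fin (N + 1)) :
    ν i = ν 0 * bdWeight lam mu i.val := by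
  suffices h : ∀ k (hk : k < N + 1), ν ⟨k, hk⟩ = ν 0 * bdWeight lam mu k from h i.val i.isLt
  intro k
  induction k with
  | zero => intro hk; rw [bdWeight_zero, mul_one]; rfl
  | succ k ih =>
    intro hk
    have hcut : lam k * ν ⟨k, by omega⟩ = mu (k + 1) * ν ⟨k + 1, hk⟩ :=
      IsInvariantQ.bd_cut hlam hmu hmu0 hlamN hν (i := ⟨k, by omega⟩) (j := ⟨k + 1, hk⟩) rfl
    have hμ : mu (k + 1) ≠ 0 := hmu' (k + 1) (by omega) (by omega)
    rw [ih (by omega)] at hcut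
    -- `λ_k ν(0) w_k = μ_{k+1} ν(k+1)` and `w_{k+1} = w_k λ_k/μ_{k+1}`
    have hν' : ν ⟨k + 1, hk⟩ = lam k * (ν 0 * bdWeight lam mu k) / mu (k + 1) := by
      rw [eq_div_iff hμ, hcut, mul_comm]
    rw [hν', bdWeight_succ]
    field_simp

/-! ## Eq. (7.50): the invariant probability distribution -/

/-- Scaling preserves invariance (`(cν)A = c(νA)`). [cite: Bremaud2020, Example 7.4.13 ("where
`π(0)` is obtained by normalization")] -/
theorem IsInvariantQ.smul {I : Type*} [Fintype I] {Q : I → I → ℝ} {ν : I → ℝ}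
    (hν : IsInvariantQ ν Q) (c : ℝ) : IsInvariantQ (fun i => c * ν i) Q := by
  intro j
  simp_rw [mul_assoc, ← mul_sum, hν j, mul_zero]

/-- Scaling preserves detailed balance. [cite: Bremaud2020, Thm 7.4.15 eq. (7.54)] -/
theorem QDetailedBalance.smul {I : Type*} [Fintype I] {Q : I → I → ℝ} {ν : I → ℝ}
    (hν : QDetailedBalance ν Q) (c : ℝ) : QDetailedBalance (fun i => c * ν i) Q := by
  intro i j
  rw [mul_assoc, hν i j, mul_assoc]

/-- The normalised law `π(i) = w_i / Σ_j w_j` (`bdLaw`) is in detailed balance with the generator.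
[cite: Bremaud2020, Thm 7.4.15 eq. (7.54); Example 7.4.13] [cite: Kelly1979, §1.3] -/
theorem qDetailedBalance_bdLaw (hmu' : ∀ k, 1 ≤ k → k ≤ N → mu k ≠ 0) :
    QDetailedBalance (bdLaw N lam mu) (bdGenerator N lam mu) := by
  have h := (qDetailedBalance_bdGenerator (lam := lam) hmu').smul
    (∑ j : Fin (N + 1), bdWeight lam mu j.val)⁻¹
  intro i j
  have hij := h i j
  simp only [bdLaw, div_eq_inv_mul] at hij ⊢
  exact hij

/-- **EQ. (7.50) (Brémaud), finite state space.**  For `λ, μ ≥ 0`, `μ_0 = λ_N = 0` and `μ_i ≠ 0`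
(`1 ≤ i ≤ N`): `π = bdLaw N λ μ`, `π(i) = π(0) Π_{n=1}^{i} λ_{n−1}/μ_n` with
`π(0) = (1 + Σ_{i≥1} Π_{n=1}^{i} λ_{n−1}/μ_n)⁻¹`, is an invariant probability vector of the
generator, and it is the ONLY one ("the ergodicity condition is, of course, automatically satisfied
when the state space is finite"). [cite: Bremaud2020, Example 7.4.13 eqs. (7.49)–(7.51)] -/
theorem Bremaud2020_eq_7_50 (hlam : ∀ k, 0 ≤ lam k) (hmu : ∀ k, 0 ≤ mu k) (hmu0 : mu 0 = 0)
    (hlamN : lam N = 0) (hmu' : ∀ k, 1 ≤ k → k ≤ N → mu k ≠ 0) :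
    (IsInvariantQ (bdLaw N lam mu) (bdGenerator N lam mu) ∧ (∑ i, bdLaw N lam mu i = 1) ∧
        ∀ i, 0 ≤ bdLaw N lam mu i) ∧
      ∀ ν : Fin (N + 1) → ℝ, IsInvariantQ ν (bdGenerator N lam mu) → ∑ i, ν i = 1 →
        ν = bdLaw N lam mu := by
  have hQ := bdGenerator_isQMatrix hlam hmu hmu0 hlamN
  refine ⟨⟨Norris1997_lemma_3_7_2 hQ (qDetailedBalance_bdLaw hmu'), sum_bdLaw hlam hmu,
    bdLaw_nonneg hlam hmu⟩, fun ν hν hν1 => ?_⟩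
  have hW := sum_bdWeight_pos (n := N) hlam hmu
  have h49 := Bremaud2020_eq_7_49 hlam hmu hmu0 hlamN hmu' hν
  -- `1 = Σ ν = ν(0) Σ w`, so `ν(0) = 1/Σ w` and `ν(i) = w_i/Σ w`
  have h0 : ν 0 * ∑ j : Fin (N + 1), bdWeight lam mu j.val = 1 := by
    rw [mul_sum, ← hν1]
    exact sum_congr rfl fun j _ => (h49 j).symm
  funext i
  rw [h49 i, bdLaw, eq_div_iff hW.ne', mul_assoc, mul_comm (bdWeight lam mu i.val), ← mul_assoc,
    h0, one_mul]

/-! ## The stationary birth-and-death process is reversible -/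

/-- `π P(t) = π` for every `t`: `bdLaw` is a stationary distribution of the transition semigroup
`P(t) = e^{tA}`. [cite: Bremaud2020, Example 7.4.13 (ergodic, stationary distribution `π`)]; via
`isStationary_ctSemigroup_of_isInvariantQ` ([cite: Norris1997, Thm 3.5.5 (finite case)]). -/
theorem bdLaw_isStationary_ctSemigroup (hlam : ∀ k, 0 ≤ lam k) (hmu : ∀ k, 0 ≤ mu k)
    (hmu0 : mu 0 = 0) (hlamN : lam N = 0) (hmu' : ∀ k, 1 ≤ k → k ≤ N → mu k ≠ 0) (t : ℝ) :
    IsStationary (bdLaw N lam mu) (ctSemigroup (bdGenerator N lam mu) t) :=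
  isStationary_ctSemigroup_of_isInvariantQ (bdGenerator_isQMatrix hlam hmu hmu0 hlamN)
    (Norris1997_lemma_3_7_2 (bdGenerator_isQMatrix hlam hmu hmu0 hlamN)
      (qDetailedBalance_bdLaw hmu')) t

/-- **A stationary birth-and-death process is reversible:** `π(i) p_{ij}(t) = π(j) p_{ji}(t)` for
all `t` and all states. [cite: Kelly1979, §1.3 ("a stationary birth and death process is
reversible")] [cite: Bremaud2020, Thm 7.4.15 (detailed balance (7.54) ⇒ reversible)] -/
theorem bdLaw_detailedBalance_ctSemigroup (hlam : ∀ k, 0 ≤ lam k) (hmu : ∀ k, 0 ≤ mu k)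
    (hmu0 : mu 0 = 0) (hlamN : lam N = 0) (hmu' : ∀ k, 1 ≤ k → k ≤ N → mu k ≠ 0) (t : ℝ) :
    DetailedBalance (bdLaw N lam mu) (ctSemigroup (bdGenerator N lam mu) t) :=
  detailedBalance_ctSemigroup_of_qDetailedBalance (bdGenerator_isQMatrix hlam hmu hmu0 hlamN)
    (qDetailedBalance_bdLaw hmu') t

end Literature.Probability.MarkovChains
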